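import Summits.ResolutionOfSingularities.ResolutionOfSingularities.Theorems.FrobeniusLadderFInjectiveMacaulayficationFDStorey1BlowupFull
import Summits.ResolutionOfSingularities.ResolutionOfSingularities.Theorems.FrobeniusLadderFInjectiveMacaulayficationFDStorey1PNotFull
import HarnessLib

/-!
# ★★ BED D STOREY 1 — THE PACKAGE FOR THE TWO-STOREY ROW: `π₁ : X₁ = Bl_{𝔪·K} X_D → X_D` is a blowing up along `𝔪̃·K̃ ≠ ⊥` cosupported at the vertex, FULL at every point except
# ONE point `P = ι(P₀)` of the open chart `ι : Spec k[Y]/(g₂₇₇) ↪ X₁`, where it is NOT FULL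
# (crux `FInjectiveMacaulayfication` stmt-ResolutionOfSingularities-15315, chain w45a; (W-TD) BED D, res-L1-w45a-plan-1 RULING R21.15 (2)(D-1) / R21.18 (4); seat res-L1-w45a-stub-2 g10;
# consumers: res-L1-w45a-stub-3 (D-2: the blow-up of `X₁` at `P`, built on `Spec k[Y]/(g₂₇₇)` at `𝔪̄_P` and transported along `ι`) and res-L1-w45a-stub-1 (D-3/`…FDTwoStoreyRow` via
# ✓ `FHalfRowOfTwoStoreys.fHalfConclusion_of_twoStoreys`))

[OURS · L1 W4.5a] Support file (`--supports stmt-ResolutionOfSingularities-15315 --as helper`); def-free, unconditional; NOT a statement of the manuscript; AI-written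
(AI review is weaker than expert review).

`storey1_package` conjoins, for `X_D = Spec k[x,y,u,t,z]/(f_D)` (`f_D = z⁴+x⁵z+x⁶+y³+u³+t⁷`, char 2, any field) and its vertex `v`:
(1) `FDStorey1Centre.storey1_isBlowup_data` — `affineBlowup.π (𝔪·K)` is a blowing up along `𝔪̃·K̃ ≠ ⊥`, supports of `𝔪̃`, `K̃` meet the generizations of `v` only in `v`
    (the hypotheses `hπ₁ hJ hsuppτ hsuppK` of `fHalfConclusion_of_twoStoreys` with `Jτ = 𝔪̃`, `JK = K̃`);
(2) `FDStorey1BlowupFull.storey1_fullCl_off_P_mul` — an open immersion `ι : Spec k[Y]/(g₂₇₇) ⟶ affineBlowup (𝔪·K)` with `π ∘ ι = Spec θ₂₇₇` such that the blow-up is FULL at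
    every point `≠ ι P₀` (`P₀` = the point with ideal `𝔪̄_P = (Y₀,Y₁,Y₂+1,Y₃,Y₄)·k[Y]/(g₂₇₇)`);
(3) `FDStorey1PNotFull.not_fullCl_of_openImmersion` — it is NOT FULL at `ι P₀`.
Readings: `g₂₇₇ = Y₂² + Y₂Y₃Y₄⁴ + 1 + Y₁³ + Y₀³ + Y₂Y₃²Y₄` (`FDStorey1PFedder.evalL_G277`), `𝔪_P = span {Y₀, Y₁, Y₂+1, Y₃, Y₄}` (`FDStorey1PIdeal.HS_map_evalL`),
`K = span (x̄^(genSet 5 KL2))` (`FDStorey1FanTables.KL2`, 1967 monomials). [OURS · assembly of landed theorems; cite: StacksProject, Tag 0804; Fedder1983, Thm. 1.12]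
-/

-- single-problem summit: the doubled namespace component is forced
set_option linter.dupNamespace false

noncomputable section

open AlgebraicGeometry CategoryTheory Literature.AlgebraicGeometry.Resolution TopologicalSpace IsLocalRing MvPolynomial

namespace Summit.ResolutionOfSingularities.ResolutionOfSingularities.Theorems.FInjectiveMacaulayfication.FDStorey1

open Summit.ResolutionOfSingularities.ResolutionOfSingularities.Theorems.FInjectiveMacaulayfication
open SliceableCentre FanCheckKit FanCheckSound FDStorey1Fan

set_option maxHeartbeats 800000 in
-- large statement
/-- ★★ **THE BED D STOREY-1 PACKAGE** (see the module docstring). [OURS · assembly of landed theorems] -/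
theorem storey1_package (k : Type) [Field k] [CharP k 2] (f : MvPolynomial (Fin 5) k) (hf : f = X 4 ^ 4 + X 0 ^ 5 * X 4 + X 0 ^ 6 + X 1 ^ 3 + X 2 ^ 3 + X 3 ^ 7)
    (v : Spec (.of (MvPolynomial (Fin 5) k ⧸ Ideal.span {f})))
    (hv : v.asIdeal = Ideal.span (Set.range fun j : Fin 5 => Ideal.Quotient.mk (Ideal.span {f}) (X j))) :
    (IsBlowup (affineBlowup.π (Ideal.span (Set.range fun j : Fin 5 => Ideal.Quotient.mk (Ideal.span {f}) (X j)) *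
        Ideal.span ((fun e : Fin 5 →₀ ℕ => Ideal.Quotient.mk (Ideal.span {f}) (monomial e (1 : k))) '' (genSet 5 KL2 : Set (Fin 5 →₀ ℕ)))))
      (affineBlowup.idealSheaf (Ideal.span (Set.range fun j : Fin 5 => Ideal.Quotient.mk (Ideal.span {f}) (X j))) *
        affineBlowup.idealSheaf (Ideal.span ((fun e : Fin 5 →₀ ℕ => Ideal.Quotient.mk (Ideal.span {f}) (monomial e (1 : k))) '' (genSet 5 KL2 : Set (Fin 5 →₀ ℕ))))) ∧
    affineBlowup.idealSheaf (Ideal.span (Set.range fun j : Fin 5 => Ideal.Quotient.mk (Ideal.span {f}) (X j))) *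
        affineBlowup.idealSheaf (Ideal.span ((fun e : Fin 5 →₀ ℕ => Ideal.Quotient.mk (Ideal.span {f}) (monomial e (1 : k))) '' (genSet 5 KL2 : Set (Fin 5 →₀ ℕ)))) ≠ ⊥ ∧
    (∀ y ∈ ((affineBlowup.idealSheaf (Ideal.span (Set.range fun j : Fin 5 => Ideal.Quotient.mk (Ideal.span {f}) (X j)))).support :
        Set (Spec (.of (MvPolynomial (Fin 5) k ⧸ Ideal.span {f})))), y ⤳ v → y = v) ∧
    (∀ y ∈ ((affineBlowup.idealSheaf (Ideal.span ((fun e : Fin 5 →₀ ℕ => Ideal.Quotient.mk (Ideal.span {f}) (monomial e (1 : k))) ''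
        (genSet 5 KL2 : Set (Fin 5 →₀ ℕ))))).support : Set (Spec (.of (MvPolynomial (Fin 5) k ⧸ Ideal.span {f})))), y ⤳ v → y = v)) ∧
    ∃ ι : Spec (.of (MvPolynomial (Fin 5) k ⧸ Ideal.span {KLocCellKit.evalL k (G (277 : Fin 327))})) ⟶
        affineBlowup (Ideal.span (Set.range fun j : Fin 5 => Ideal.Quotient.mk (Ideal.span {f}) (X j)) *
          Ideal.span ((fun e : Fin 5 →₀ ℕ => Ideal.Quotient.mk (Ideal.span {f}) (monomial e (1 : k))) '' (genSet 5 KL2 : Set (Fin 5 →₀ ℕ)))),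
      IsOpenImmersion ι ∧
      (∀ q : Spec (.of (MvPolynomial (Fin 5) k ⧸ Ideal.span {KLocCellKit.evalL k (G (277 : Fin 327))})),
        ((affineBlowup.π _).base (ι.base q)).asIdeal.comap (Ideal.Quotient.mk (Ideal.span {f})) =
          q.asIdeal.comap ((Ideal.Quotient.mk (Ideal.span {KLocCellKit.evalL k (G (277 : Fin 327))})).comp
            (aeval (fun j : Fin 5 => ∏ i : Fin 5, (X i : MvPolynomial (Fin 5) k) ^ Vq (277 : Fin 327) i j)).toRingHom)) ∧
      ∀ P₀ : Spec (.of (MvPolynomial (Fin 5) k ⧸ Ideal.span {KLocCellKit.evalL k (G (277 : Fin 327))})),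
        P₀.asIdeal = (Ideal.span {x | x ∈ HS.map (KLocCellKit.evalL k)}).map (Ideal.Quotient.mk (Ideal.span {KLocCellKit.evalL k (G (277 : Fin 327))})) →
        (∀ y : ↥(affineBlowup (Ideal.span (Set.range fun j : Fin 5 => Ideal.Quotient.mk (Ideal.span {f}) (X j)) *
          Ideal.span ((fun e : Fin 5 →₀ ℕ => Ideal.Quotient.mk (Ideal.span {f}) (monomial e (1 : k))) '' (genSet 5 KL2 : Set (Fin 5 →₀ ℕ))))),
          y ≠ ι.base P₀ →
          FullCl 2 ((affineBlowup (Ideal.span (Set.range fun j : Fin 5 => Ideal.Quotient.mk (Ideal.span {f}) (X j)) *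
            Ideal.span ((fun e : Fin 5 →₀ ℕ => Ideal.Quotient.mk (Ideal.span {f}) (monomial e (1 : k))) '' (genSet 5 KL2 : Set (Fin 5 →₀ ℕ))))).presheaf.stalk y)) ∧
        ¬ FullCl 2 ((affineBlowup (Ideal.span (Set.range fun j : Fin 5 => Ideal.Quotient.mk (Ideal.span {f}) (X j)) *
            Ideal.span ((fun e : Fin 5 →₀ ℕ => Ideal.Quotient.mk (Ideal.span {f}) (monomial e (1 : k))) '' (genSet 5 KL2 : Set (Fin 5 →₀ ℕ))))).presheaf.stalk (ι.base P₀)) := by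
  obtain ⟨ι, hιo, hcompat, hfull⟩ := FDStorey1BlowupFull.storey1_fullCl_off_P_mul k f hf
  refine ⟨FDStorey1Centre.storey1_isBlowup_data k f hf v hv, ι, hιo, hcompat, fun P₀ hP₀ => ⟨hfull P₀ hP₀, ?_⟩⟩
  haveI := hιo
  exact FDStorey1PNotFull.not_fullCl_of_openImmersion k ι P₀ hP₀

end Summit.ResolutionOfSingularities.ResolutionOfSingularities.Theorems.FInjectiveMacaulayfication.FDStorey1

end
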